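import Summits.CriticalPhenomena.PercolationContinuityZ3.Theorems.PercNearOneGluingNoHeavyLowerTailThreePointVarianceBehindCutVertex
import HarnessLib

/-!
# The three-point variance row passes from a cut vertex `v` to a TERMINAL behind it — every finite weighted graph

Support file for crux `stmt-CriticalPhenomena-4575` (`NoHeavyLowerTail`), seat `prim-l12-p1` gen 20 (`--supports stmt-CriticalPhenomena-4575`).
Memo `run/shared/lean/prim/prim-l12/FROM-prim-l12-p1-g20-PARALLEL-PIECES.md` §1b.

Bond percolation `μ = prodBernoulli w` (arbitrary pair weights, finite vertex type `V`).  Write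
`(3PT)(a,b;c) :  P(a↔b)·P(a↮b) ≤ P(a↔b, a↮c) + P(a↔c, a↮b) + P(b↔c, a↮b)`.
Gen 16 proved the reduction for the THIRD vertex behind a cut vertex (`threePointVariance_behindCutVertex`: `(3PT)(a,b;v) ⟹ (3PT)(a,b;c)`
for `c` behind `v`).  THIS FILE is the companion for a PAIR vertex [this work]: if the terminal `a` lies behind a vertex `v` — a vertex set
`S ∋ a` with `v, b, c ∉ S` and every pair between `S` and `V ∖ (S ∪ {v})` of weight `0` (the simplest case: `a` a pendant vertex hanging
at `v`) — then

  `(3PT)(v,b;c) ⟹ (3PT)(a,b;c)`.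

So a vertex-minimal counterexample to `(3PT)` has no terminal of the pair `{a,b}` behind a cut vertex (in particular `deg a, deg b ≥ 2`
and no pendant paths at `a`, `b`); with gen 18's two-neighbour reduction (`deg c ≥ 3`) and gen 19's `ab`-edge reduction.
Proof: off a null set, `{a↔b} = In ∩ {b↔v outside S}`, `{a↔c} = In ∩ {c↔v outside}`, `{b↔c} = {b↔c outside}` with
`In = {a↔v inside S ∪ {v}}` independent of the outside events (probability `r`); the cells of `(a,b;c)` are `θ = rθ'`, `s = rs'`, `t = rt'`,
`u = u' + (1−r)x'` in terms of those of `(v,b;c)` (`x' = P(v↔b, v↔c)`), and the claim is the algebra `behind_algebra`: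
`r t' + u' + (1−2r)x' + r²θ'² ≥ 0`, trivially for `r ≤ 1/2` and from the `x`-form `x' ≤ t' + u' + θ'²` of the hypothesis for `r ≥ 1/2`.
-/

namespace Summit.CriticalPhenomena.PercolationContinuityZ3.Theorems.ThreePointVarianceTerminalBehindCutVertex

open MeasureTheory Set
open Literature.Probability.Percolation Literature.Probability.LatticeModels
open Summit.CriticalPhenomena.PercolationContinuityZ3.Theorems.ThreePointVarianceCutVertex
open Summit.CriticalPhenomena.PercolationContinuityZ3.Theorems.ThreePointVarianceBehindCutVertex (openConn_out_iff)

variable {V : Type*} [Fintype V] [DecidableEq V]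

/-- **The algebra of the reduction.**  If `θ(1−θ) ≤ (θ−x) + t + u` (the row for `(v,b;c)` with cells `s' = θ−x, t, u`), then for
`0 ≤ r ≤ 1`: `rθ(1−rθ) ≤ r(θ−x) + rt + (u + x − rx)` (the row for `(a,b;c)`). [this work] -/
theorem behind_algebra {r θ x t u : ℝ} (hr0 : 0 ≤ r) (hr1 : r ≤ 1) (hx : 0 ≤ x) (ht : 0 ≤ t) (hu : 0 ≤ u)
    (hyp : θ * (1 - θ) ≤ (θ - x) + t + u) : r * θ * (1 - r * θ) ≤ r * (θ - x) + r * t + (u + x - r * x) := by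
  -- `RHS − LHS = r t + u + (1 − 2r) x + r² θ²`
  have key : r * (θ - x) + r * t + (u + x - r * x) - r * θ * (1 - r * θ) = r * t + u + (1 - 2 * r) * x + r ^ 2 * θ ^ 2 := by ring
  rcases le_total r (1 / 2) with h | h
  · nlinarith [key, mul_nonneg hr0 ht, mul_nonneg (by linarith : 0 ≤ 1 - 2 * r) hx, sq_nonneg (r * θ)]
  · -- `x ≤ t + u + θ²` from the hypothesis, times `2r − 1 ≥ 0`
    have hx' : x ≤ t + u + θ ^ 2 := by nlinarith [hyp]
    nlinarith [key, mul_le_mul_of_nonneg_left hx' (by linarith : 0 ≤ 2 * r - 1), mul_nonneg (sub_nonneg.2 hr1) ht,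
      mul_nonneg (sub_nonneg.2 hr1) hu, mul_nonneg (mul_nonneg (sub_nonneg.2 hr1) (sub_nonneg.2 hr1)) (sq_nonneg θ)]

/-- **Reduction lemma**: `(3PT)(v,b;c) ⟹ (3PT)(a,b;c)` whenever the terminal `a` lies behind `v` (a set `S ∋ a` with `v,b,c ∉ S`
whose pairs to `V ∖ (S ∪ {v})` all have weight `0`), on every finite weighted graph. [this work] -/
theorem threePointVariance_terminalBehindCutVertex (w : Sym2 V → unitInterval) {a b c v : V} (S : Finset V) (ha : a ∈ S)
    (hv : v ∉ S) (hb : b ∉ S) (hc : c ∉ S) (hw : ∀ u ∈ S, ∀ x, x ∉ S → x ≠ v → (w s(u, x) : ℝ) = 0)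
    (hyp : (prodBernoulli w).real (openConn v b) * (prodBernoulli w).real (openConn v b)ᶜ ≤
      (prodBernoulli w).real (openConn v b ∩ (openConn v c)ᶜ) + (prodBernoulli w).real (openConn v c ∩ (openConn v b)ᶜ) +
        (prodBernoulli w).real (openConn b c ∩ (openConn v b)ᶜ)) :
    (prodBernoulli w).real (openConn a b) * (prodBernoulli w).real (openConn a b)ᶜ ≤
      (prodBernoulli w).real (openConn a b ∩ (openConn a c)ᶜ) + (prodBernoulli w).real (openConn a c ∩ (openConn a b)ᶜ) +
        (prodBernoulli w).real (openConn b c ∩ (openConn a b)ᶜ) := by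
  have hN : (prodBernoulli w).real (bad S v) = 0 := real_bad w S v hw
  set T := (Finset.univ.filter fun z => z ∉ S) with hT
  set VB := reachIn T b v with hVB
  set VC := reachIn T c v with hVC
  set BC := reachIn T b c with hBC
  set In := reachIn (insert v S) a v with hIn
  have hdVB : DeterminedBy VB (↑(pairsIn T) : Set (Sym2 V)) := determinedBy_reachIn T b v
  have hdVC : DeterminedBy VC (↑(pairsIn T) : Set (Sym2 V)) := determinedBy_reachIn T c v
  have hdBC : DeterminedBy BC (↑(pairsIn T) : Set (Sym2 V)) := determinedBy_reachIn T b c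
  have hdIn : DeterminedBy In (↑(pairsIn (insert v S)) : Set (Sym2 V)) := determinedBy_reachIn _ a v
  have hind : ∀ {X : Set (BondConfig V)}, DeterminedBy X (↑(pairsIn T) : Set (Sym2 V)) →
      (prodBernoulli w).real (In ∩ X) = (prodBernoulli w).real In * (prodBernoulli w).real X :=
    fun hX => prodBernoulli_real_inter_of_determinedBy_disjoint w (disjoint_pairsIn S v hv) hdIn hX
      MeasurableSet.of_discrete MeasurableSet.of_discrete
  have nul := real_inter_compl_of_null w hN
  -- off the null set: the true events in terms of In and the out-events
  have i_ab : ∀ {ω}, ω ∉ bad S v → (ω ∈ openConn a b ↔ ω ∈ In ∧ ω ∈ VB) := fun {ω} hn => by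
    rw [openConn_ab_iff ha hb hn, openConn_ac_iff ha hv hn, openConn_bc_iff hb hn]
  have i_ac : ∀ {ω}, ω ∉ bad S v → (ω ∈ openConn a c ↔ ω ∈ In ∧ ω ∈ VC) := fun {ω} hn => by
    rw [openConn_ab_iff ha hc hn, openConn_ac_iff ha hv hn, openConn_bc_iff hc hn]
  have i_bc : ∀ {ω}, ω ∉ bad S v → (ω ∈ openConn b c ↔ ω ∈ BC) := fun {ω} hn => openConn_out_iff hv hn hb hc
  -- `openConn` is symmetric (as sets)
  have symm : ∀ x y : V, (openConn x y : Set (BondConfig V)) = openConn y x := fun x y => by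
    ext ω; exact ⟨fun h => SimpleGraph.Reachable.symm h, fun h => SimpleGraph.Reachable.symm h⟩
  have i_vb : ∀ {ω}, ω ∉ bad S v → (ω ∈ openConn v b ↔ ω ∈ VB) := fun {ω} hn => by
    rw [symm v b]; exact openConn_bc_iff hb hn
  have i_vc : ∀ {ω}, ω ∉ bad S v → (ω ∈ openConn v c ↔ ω ∈ VC) := fun {ω} hn => by
    rw [symm v c]; exact openConn_bc_iff hc hn
  -- transitivity inside `T`: `b ↔ v` and `c ↔ v` outside iff `b ↔ v` and `b ↔ c` outside
  have hX : VB ∩ VC = BC ∩ VB := by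
    ext ω
    simp only [mem_inter_iff, hVB, hVC, hBC, reachIn, mem_setOf_eq]
    constructor
    · rintro ⟨h1, h2⟩; exact ⟨h1.trans h2.symm, h1⟩
    · rintro ⟨h1, h2⟩; exact ⟨h2, h1.symm.trans h2⟩
  -- probabilities (equal off the null set)
  have meq : ∀ {X Y : Set (BondConfig V)}, (∀ ω, ω ∉ bad S v → (ω ∈ X ↔ ω ∈ Y)) →
      (prodBernoulli w).real X = (prodBernoulli w).real Y := by
    intro X Y h
    have e : X ∩ (bad S v)ᶜ = Y ∩ (bad S v)ᶜ := by
      ext ω; simp only [mem_inter_iff, mem_compl_iff]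
      exact ⟨fun ⟨hx, hn⟩ => ⟨(h ω hn).1 hx, hn⟩, fun ⟨hy, hn⟩ => ⟨(h ω hn).2 hy, hn⟩⟩
    rw [← nul X, e, nul]
  set r := (prodBernoulli w).real In with hrdef
  set θ' := (prodBernoulli w).real VB with hθ'def
  set x' := (prodBernoulli w).real (VB ∩ VC) with hx'def
  set t' := (prodBernoulli w).real (VC ∩ VBᶜ) with ht'def
  set u' := (prodBernoulli w).real (BC ∩ VBᶜ) with hu'def
  -- hypothesis side
  have g_vb : (prodBernoulli w).real (openConn v b) = θ' := meq fun ω hn => i_vb hn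
  have g_vbc : (prodBernoulli w).real (openConn v b)ᶜ = 1 - θ' := by
    rw [probReal_compl_eq_one_sub MeasurableSet.of_discrete, g_vb]
  have g_s : (prodBernoulli w).real (openConn v b ∩ (openConn v c)ᶜ) = θ' - x' := by
    have h1 : (prodBernoulli w).real (openConn v b ∩ (openConn v c)ᶜ) = (prodBernoulli w).real (VB ∩ VCᶜ) :=
      meq fun ω hn => by simp only [mem_inter_iff, mem_compl_iff, i_vb hn, i_vc hn]
    have h2 := measureReal_inter_add_sdiff (μ := prodBernoulli w) (s := VB) (t := VC) MeasurableSet.of_discrete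
    rw [Set.sdiff_eq] at h2
    rw [h1]; linarith
  have g_t : (prodBernoulli w).real (openConn v c ∩ (openConn v b)ᶜ) = t' :=
    meq fun ω hn => by simp only [mem_inter_iff, mem_compl_iff, i_vb hn, i_vc hn]
  have g_u : (prodBernoulli w).real (openConn b c ∩ (openConn v b)ᶜ) = u' :=
    meq fun ω hn => by simp only [mem_inter_iff, mem_compl_iff, i_bc hn, i_vb hn]
  -- conclusion side
  have f_ab : (prodBernoulli w).real (openConn a b) = r * θ' := by
    rw [meq (Y := In ∩ VB) fun ω hn => i_ab hn, hind hdVB]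
  have f_abc : (prodBernoulli w).real (openConn a b)ᶜ = 1 - r * θ' := by
    rw [probReal_compl_eq_one_sub MeasurableSet.of_discrete, f_ab]
  have f_s : (prodBernoulli w).real (openConn a b ∩ (openConn a c)ᶜ) = r * (θ' - x') := by
    have h1 : (prodBernoulli w).real (openConn a b ∩ (openConn a c)ᶜ) = (prodBernoulli w).real (In ∩ (VB ∩ VCᶜ)) :=
      meq fun ω hn => by simp only [mem_inter_iff, mem_compl_iff, i_ab hn, i_ac hn]; tauto
    have h2 := measureReal_inter_add_sdiff (μ := prodBernoulli w) (s := VB) (t := VC) MeasurableSet.of_discrete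
    rw [Set.sdiff_eq] at h2
    rw [h1, hind (hdVB.inter (OneLayerTwoFinger.determinedBy_compl hdVC))]
    have : (prodBernoulli w).real (VB ∩ VCᶜ) = θ' - x' := by linarith
    rw [this]
  have f_t : (prodBernoulli w).real (openConn a c ∩ (openConn a b)ᶜ) = r * t' := by
    have h1 : (prodBernoulli w).real (openConn a c ∩ (openConn a b)ᶜ) = (prodBernoulli w).real (In ∩ (VC ∩ VBᶜ)) :=
      meq fun ω hn => by simp only [mem_inter_iff, mem_compl_iff, i_ab hn, i_ac hn]; tauto
    rw [h1, hind (hdVC.inter (OneLayerTwoFinger.determinedBy_compl hdVB))]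
  have f_u : (prodBernoulli w).real (openConn b c ∩ (openConn a b)ᶜ) = u' + x' - r * x' := by
    have h1 : (prodBernoulli w).real (openConn b c ∩ (openConn a b)ᶜ) = (prodBernoulli w).real (BC \ (In ∩ (BC ∩ VB))) :=
      meq fun ω hn => by simp only [mem_inter_iff, mem_compl_iff, mem_sdiff, i_ab hn, i_bc hn]; tauto
    have h2 := measureReal_sdiff_add_inter (μ := prodBernoulli w) (s := BC) (t := In ∩ (BC ∩ VB)) MeasurableSet.of_discrete
    have h3 : (prodBernoulli w).real (BC ∩ (In ∩ (BC ∩ VB))) = r * x' := by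
      rw [show BC ∩ (In ∩ (BC ∩ VB)) = In ∩ (BC ∩ VB) by ext ω; simp only [mem_inter_iff]; tauto, hind (hdBC.inter hdVB),
        ← hX]
    have h4 := measureReal_inter_add_sdiff (μ := prodBernoulli w) (s := BC) (t := VB) MeasurableSet.of_discrete
    rw [Set.sdiff_eq, ← hX] at h4
    rw [h1]; linarith
  -- ranges and the algebra
  have hr0 : 0 ≤ r := measureReal_nonneg
  have hr1 : r ≤ 1 := measureReal_le_one
  have hx0 : 0 ≤ x' := measureReal_nonneg
  have ht0 : 0 ≤ t' := measureReal_nonneg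
  have hu0 : 0 ≤ u' := measureReal_nonneg
  rw [g_vb, g_vbc, g_s, g_t, g_u] at hyp
  rw [f_ab, f_abc, f_s, f_t, f_u]
  have := behind_algebra hr0 hr1 hx0 ht0 hu0 hyp
  linarith

end Summit.CriticalPhenomena.PercolationContinuityZ3.Theorems.ThreePointVarianceTerminalBehindCutVertex
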